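import Mathlib
import Summits.AtomisticToContinuum.HydrodynamicLimit.Theorems.ImplosionDichotomyDenseExcursionR2Modes

/-!
# Lagrange identity for the radial linearised operator — stub `stub_lagrangeIdentity` (N4)

Crux `Summit.AtomisticToContinuum.HydrodynamicLimit.Theses.ImplosionDichotomy.DenseExcursion`
(stmt-AtomisticToContinuum-12586), line `r2-one-mode-two-conditions`, registered stub
`stub_lagrangeIdentity : LagrangeIdentity` (operator `(linW, linS)` from
`…Theorems.ImplosionDichotomyDenseExcursionR2Modes`).

**Mathematics.** `(linW, linS)` is the radial isentropic Euler operator linearised in self-similar variables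
around a profile `(W, S)` (real functions of `x = log y`), acting on complex perturbations `(ŵ, ŝ) : ℝ → ℂ²`:
`linW = (W-1) ŵ' + 3S ŝ' + (W' + 2W - r) ŵ + (3S' + 6S) ŝ`,
`linS = (S/3) ŵ' + (W-1) ŝ' + (S' + 2S) ŵ + (W'/3 + 2W - r) ŝ`.
For the plain pairing `∫ (a ŵ + b ŝ) dx` its FORMAL ADJOINT is
`adjW = -(W-1) a' - (S/3) b' + (2W - r) a + (2S + (2/3)S') b`,
`adjS = -3S a' - (W-1) b' + 6S a + (2W - r - (2/3)W') b`,
with bilinear boundary form `lagrangeForm = ((W-1) a + (S/3) b) ŵ + (3S a + (W-1) b) ŝ`, and the pointwise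
LAGRANGE IDENTITY `a·linW + b·linS - (adjW·ŵ + adjS·ŝ) = (lagrangeForm)'` holds wherever `W, S, a, b, ŵ, ŝ`
are differentiable: it is the product rule (the zeroth-order coefficients of `L` minus those of `L*` are exactly
the derivatives `W'`, `3S'`, `S'/3`, `W'` of the first-order coefficients). The proof builds `HasDerivAt` of
`lagrangeForm` from the pieces (`HasDerivAt.ofReal_comp` for the real profile casts), rewrites `deriv`, and
closes by `push_cast; ring`. Folklore one-variable calculus; no cited facts.
-/

noncomputable section

open Filter Set
open scoped Topology

namespace Summit.AtomisticToContinuum.HydrodynamicLimit.Theorems.R2OneModeTwoConditions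

/-! ## Formal adjoint of the radial linearised operator and the boundary form (verbatim: skeleton §0c-2) -/

/-- `w`-component of the FORMAL ADJOINT `L*` of `(linW, linS)` for the plain pairing `∫ (a ŵ + b ŝ) dx`:
`-(W-1) a' - (S/3) b' + (2W - r) a + (2S + (2/3)S') b`. -/
def adjW (r : ℝ) (W S : ℝ → ℝ) (a b : ℝ → ℂ) (x : ℝ) : ℂ :=
  -((W x - 1 : ℝ) : ℂ) * deriv a x - ((S x / 3 : ℝ) : ℂ) * deriv b x +
    ((2 * W x - r : ℝ) : ℂ) * a x + ((2 * S x + 2 / 3 * deriv S x : ℝ) : ℂ) * b x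

/-- `s`-component of the formal adjoint: `-3S a' - (W-1) b' + 6S a + (2W - r - (2/3)W') b`. -/
def adjS (r : ℝ) (W S : ℝ → ℝ) (a b : ℝ → ℂ) (x : ℝ) : ℂ :=
  -((3 * S x : ℝ) : ℂ) * deriv a x - ((W x - 1 : ℝ) : ℂ) * deriv b x +
    ((6 * S x : ℝ) : ℂ) * a x + ((2 * W x - r - 2 / 3 * deriv W x : ℝ) : ℂ) * b x

/-- The bilinear BOUNDARY FORM of the Lagrange identity: `(a(W-1) + bS/3) ŵ + (3aS + b(W-1)) ŝ`. At the sonic point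
`S = 1 - W` it degenerates to `(1-W)·(b/3 - a)(ŵ - 3ŝ)`-type rank-one forms (causality of the Melnikov pairing). -/
def lagrangeForm (W S : ℝ → ℝ) (a b ŵ ŝ : ℝ → ℂ) (x : ℝ) : ℂ :=
  (((W x - 1 : ℝ) : ℂ) * a x + ((S x / 3 : ℝ) : ℂ) * b x) * ŵ x +
    (((3 * S x : ℝ) : ℂ) * a x + ((W x - 1 : ℝ) : ℂ) * b x) * ŝ x

/-- Statement of `stub_lagrangeIdentity` (N4): the pointwise LAGRANGE IDENTITY
`a·linW + b·linS - (adjW·ŵ + adjS·ŝ) = (lagrangeForm)'` for `W, S, a, b, ŵ, ŝ` differentiable at `x`. Integrated over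
`(-∞, x_s]` against a smooth mode and an adjoint mode it gives `(Λ - λ)∫(aŵ + bŝ) = boundary terms`, i.e. biorthogonality and
the representation of the unstable coordinate as the pairing with the adjoint mode `w₁` — the backbone of `K₁ = ⟨w₁, ·⟩`. -/
def LagrangeIdentity : Prop :=
  ∀ (r : ℝ) (W S : ℝ → ℝ) (a b ŵ ŝ : ℝ → ℂ) (x : ℝ),
    DifferentiableAt ℝ W x → DifferentiableAt ℝ S x → DifferentiableAt ℝ a x → DifferentiableAt ℝ b x →
    DifferentiableAt ℝ ŵ x → DifferentiableAt ℝ ŝ x →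
    a x * linW r W S ŵ ŝ x + b x * linS r W S ŵ ŝ x - (adjW r W S a b x * ŵ x + adjS r W S a b x * ŝ x) =
      deriv (lagrangeForm W S a b ŵ ŝ) x

/-! ## The Lagrange identity (N4) -/

/-- **LAGRANGE IDENTITY** (stub N4) for the radial linearised operator `(linW, linS)`, its formal adjoint
`(adjW, adjS)` and the boundary form `lagrangeForm`: pointwise, for `W, S, a, b, ŵ, ŝ` differentiable at `x`,
`a·linW + b·linS - (adjW·ŵ + adjS·ŝ) = (lagrangeForm)'(x)`. Product rule: `HasDerivAt` of `lagrangeForm` is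
assembled from the pieces (real profile casts via `HasDerivAt.ofReal_comp`), then `push_cast; ring`. [folklore] -/
theorem stub_lagrangeIdentity : LagrangeIdentity := by
  intro r W S a b ŵ ŝ x hW hS ha hb hŵ hŝ
  -- the real first-order coefficients, cast to `ℂ`, with their derivatives
  have hW1 : HasDerivAt (fun y => ((W y - 1 : ℝ) : ℂ)) ((deriv W x : ℝ) : ℂ) x :=
    (hW.hasDerivAt.sub_const 1).ofReal_comp
  have hS3 : HasDerivAt (fun y => ((S y / 3 : ℝ) : ℂ)) ((deriv S x / 3 : ℝ) : ℂ) x :=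
    (hS.hasDerivAt.div_const 3).ofReal_comp
  have h3S : HasDerivAt (fun y => ((3 * S y : ℝ) : ℂ)) ((3 * deriv S x : ℝ) : ℂ) x :=
    (hS.hasDerivAt.const_mul 3).ofReal_comp
  -- product rule for the boundary form
  have key : HasDerivAt (lagrangeForm W S a b ŵ ŝ) _ x :=
    (((hW1.fun_mul ha.hasDerivAt).fun_add (hS3.fun_mul hb.hasDerivAt)).fun_mul hŵ.hasDerivAt).fun_add
      (((h3S.fun_mul ha.hasDerivAt).fun_add (hW1.fun_mul hb.hasDerivAt)).fun_mul hŝ.hasDerivAt)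
  rw [key.deriv]
  simp only [linW, linS, adjW, adjS]
  push_cast
  ring

end Summit.AtomisticToContinuum.HydrodynamicLimit.Theorems.R2OneModeTwoConditions

end
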